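import Literature.IUT.LogVolume.ArchimedeanTensorCopiesProofs
import Mathlib.LinearAlgebra.Dimension.Finite
import Mathlib.LinearAlgebra.Complex.FiniteDimensional
import HarnessLib

/-!
# [IUTchIV] Proposition 1.5 (iv): the typed statement holds for an ARBITRARY label set `V`

S. Mochizuki, *Inter-universal Teichmüller theory IV*, §1, Proposition 1.5 (iv) "(Tensor Product of
Vectors of a Given Length)", p. 16: "Fix `λ ∈ ℝ_{>0}`.  Then `M_I ∋ ⊗_{i∈I} m_i ∈ λ^{|I|}·B_I` for any
collection of elements `{m_i ∈ M_i}_{i∈I}` such that the component of `m_i` in each direct summand `ℂ_v`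
of `M_i` is of length `λ`" [claim: Mochizuki2012, status: disputed] (D-0012 claim key; the content used
here is undisputed linear algebra).

PROOF-ONLY companion of `ArchimedeanTensorCopies.lean` / `ArchimedeanTensorCopiesProofs.lean`
(abc-iut S lane).  The kernel constant `Prop15iii.Prop15iv I V` has binders `(I V : Type) [Fintype I]`
only — the label set `V` of the copies `ℂ_v` carries NO finiteness (the statement quantifies over direct
sum decompositions `Φ : M_I ≃ₐ[ℝ] ℂ^J` with `J` finite); the landed witness `prop15iv_holds` assumes
`[Fintype V] [DecidableEq V] [DecidableEq I]`, so it proves the universal closure of the constant only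
for finite `V` (abc-iut FACT-LIST row F-2229, R7 kernel type-audit verdict DEMOTE:EXTRA-DATA-HYP,
abc-iut-w5-d088 gen 2; the `DecidableEq` instances are supplied classically).

This file proves the closure EXACTLY AS TYPED.  For finite `V` it is the landed witness.  For
INFINITE `V` (and `I ≠ ∅`) no decomposition `M_I ≃ₐ[ℝ] ℂ^J` with `J` finite exists, so the statement is
vacuous: the pure tensors `⊗_i δ_v`, `v ∈ V`, are linearly independent in `M_I` (they are separated by
the characters `χ_{v,id}` of `ArchimedeanTensorCopies.lean`), while `ℂ^J` is finite-dimensional over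
`ℝ`.  For `I = ∅` the statement holds outright (`⊗_∅ m = 1`, `Φ 1 = 1`, `λ^0·B_I = B_I ∋ 1`).  No new
definitions; in print `V` is finite — this only aligns the kernel constant with its witness.
-/

noncomputable section

namespace Literature.IUT.LogVolume

namespace Prop15iii

open scoped TensorProduct Pointwise
open Complex PiTensorProduct

/-- For `I ≠ ∅` and `V` infinite, the pure tensors `⊗_{i ∈ I} δ_v ∈ M_I` (`δ_v ∈ M = ⊕_v ℂ_v` the
`v`-th unit vector), `v ∈ V`, are `ℝ`-linearly independent: the character `χ_{w ≡ v, ε ≡ id}` takes the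
value `1` on `⊗_i δ_v` and `0` on `⊗_i δ_{v'}`, `v' ≠ v`. [claim: Mochizuki2012, status: disputed] -/
private theorem linearIndependent_tprod_single (I V : Type) [Fintype I] [Nonempty I] [DecidableEq V] :
    LinearIndependent ℝ (fun v : V => tprod ℝ fun _ : I => (Pi.single v (1 : ℂ) : M V)) := by
  have key : ∀ x v : V, character I V (fun _ => v) (fun _ => false)
      (tprod ℝ fun _ : I => (Pi.single x (1 : ℂ) : M V)) = if x = v then 1 else 0 := by
    intro x v
    rw [character_tprod]
    simp only [cj_false, Finset.prod_const, Finset.card_univ]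
    by_cases hx : x = v
    · subst hx
      rw [if_pos rfl, Pi.single_eq_same, one_pow]
    · rw [if_neg hx, Pi.single_eq_of_ne (Ne.symm hx), zero_pow Fintype.card_ne_zero]
  rw [linearIndependent_iff']
  intro s g hg x hx
  have h := congrArg (character I V (fun _ => x) (fun _ => false)) hg
  rw [map_sum, map_zero] at h
  simp_rw [map_smul, key] at h
  rw [Finset.sum_eq_single x (fun y _ hy => by rw [if_neg hy, smul_zero])
    (fun hxs => (hxs hx).elim), if_pos rfl] at h
  exact (smul_eq_zero.mp h).resolve_right one_ne_zero

/-- **[IUTchIV] Prop. 1.5 (iv)** — FACT-LIST F-2229: the UNIVERSAL CLOSURE of the kernel constant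
`Prop15iii.Prop15iv` exactly as typed (binders `I V : Type`, `[Fintype I]`; NO `Fintype`/`DecidableEq`
on `V`), PROVED: for finite `V` by the landed witness `prop15iv_holds`; for `I = ∅` directly
(`⊗_∅ m = 1 ∈ B_I = λ^0·B_I`); for `I ≠ ∅` and infinite `V` vacuously, since then `M_I` contains the
infinite linearly independent family `⊗_i δ_v` and admits no `ℝ`-algebra isomorphism onto a
finite-dimensional `ℂ^J`. [claim: Mochizuki2012, status: disputed] -/
theorem Prop15iv_closure : ∀ (I V : Type) [Fintype I], Prop15iv I V := by
  intro I V _ J _ Φ r hr m hm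
  classical
  rcases isEmpty_or_nonempty I with hI | hI
  · -- `I = ∅`
    have hm1 : tprod ℝ m = 1 := by
      have : m = 1 := funext fun i => (hI.false i).elim
      rw [this, PiTensorProduct.one_def]
    rw [hm1, Fintype.card_eq_zero, pow_zero, one_smul]
    show ∀ j, ‖Φ 1 j‖ ≤ 1
    intro j
    rw [map_one, Pi.one_apply, norm_one]
  · by_cases hV : Finite V
    · haveI := Fintype.ofFinite V
      exact prop15iv_holds J Φ r hr m hm
    · exfalso
      haveI : Infinite V := not_finite_iff_infinite.mp hV
      haveI : Module.Finite ℝ (MI I V) := Module.Finite.equiv Φ.toLinearEquiv.symm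
      exact Module.Finite.not_linearIndependent_of_infinite _ (linearIndependent_tprod_single I V)

end Prop15iii

end Literature.IUT.LogVolume

end
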